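import Summits.ABC.ABC.Theorems.IsogenyGlueCongruenceEllipticGluingPrimeBoundStubAbelianKernelMinkowskiCore
import Literature.NumberTheory.GaloisRepresentations.NormalSubgroupsGL2
import HarnessLib

/-!
# Crux `EllipticGluingPrimeBound`, line SketchIdeator5 — stub `stub_imageDichotomyCore`
# (algebraic core of the endomorphism-field DICHOTOMY)

Stub `stub_imageDichotomyCore` of line `SketchIdeator5` (slices of the free branch `U_simple`) of
crux U `Summit.ABC.ABC.Theses.IsogenyGlueCongruence.EllipticGluingPrimeBound` (item stmt-ABC-13919),
registered signature (namespace `Summit.ABC.ABC.Theorems.GluingSlices`).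

**Statement.** Let `Γ` act `ℤ`-linearly with finite image on a lattice `H` of finite rank (`ρ`)
and ONTO the automorphism group of an abelian group `V` with `#V = ℓ²`, `ℓ V = 0` (`π`), `ℓ ≥ 5`
prime.  Then EITHER `ℓ ≤ rank H + 1`, OR the image `π(ker ρ)` of the kernel of the lattice action
contains the whole commutator subgroup of `Aut V` (`= SL₂(𝔽_ℓ)` under `Aut V ≅ GL₂(𝔽_ℓ)`).

**Proof.** `Aut V ≅ GL₂(ℤ/ℓ)` (`exists_generalLinearGroup_mulEquiv`: a basis of the plane `V`;
the worker's `exists_generalLinearGroup_hom_injective` upgraded to an isomorphism).  `N = π(ker ρ)`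
is normal (`π` is onto), so by Artin's theorem (the tree's
`toGL_range_le_or_le_center_of_normal_zmod`, `ℓ ≥ 5`) its preimage in `GL₂(ℤ/ℓ)` either contains
`SL₂(ℤ/ℓ) = ker det ⊇ [GL₂, GL₂]`, giving the second alternative, or is central; in the latter case
the unipotent `(1 1; 0 1)` (order `ℓ`, not central: `exists_unipotent_swap`) survives in `Aut V / N`,
so `ℓ ∣ [Aut V : N] ∣ [Γ : ker ρ] = #ρ(Γ)`, and `ρ(Γ)` is a finite subgroup of `GL_m(ℤ)`,
`m = rank H` (`BigImage.exists_subgroup_generalLinearGroup_mulEquiv`), whence Minkowski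
(`stub_minkowski`) gives the first alternative.  The abelian core `stub_abelianKernelMinkowskiCore`
(p125338) is the special case "`π(ker ρ)` abelian".  No named facts; no definitions.
-/

noncomputable section

-- `Summit.<Summit>.<Problem>` is the mandated summit-side namespace (CONVENTIONS §2); for the
-- single-conjunct summit `ABC` the two coincide, so the duplicate `ABC.ABC` is deliberate.
set_option linter.dupNamespace false

namespace Summit.ABC.ABC.Theorems.GluingSlices

open Summit.ABC.ABC.Theorems.IsotypicMinkowski
open scoped MatrixGroups

/-- **`Aut V ≅ GL₂(ℤ/ℓ)` for a plane `V`.** For a `ℤ/ℓ`-module `V` with `#V = ℓ²` (`ℓ` prime) a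
basis yields a group ISOMORPHISM `GL₂(ℤ/ℓ) ≃* Aut(V)` (matrix ↦ invertible linear map ↦ its
underlying additive automorphism; every additive automorphism of `V` is `ℤ/ℓ`-linear). -/
theorem exists_generalLinearGroup_mulEquiv {ℓ : ℕ} [Fact ℓ.Prime] (V : Type)
    [AddCommGroup V] [Module (ZMod ℓ) V] (hcard : Nat.card V = ℓ ^ 2) :
    Nonempty (Matrix.GeneralLinearGroup (Fin 2) (ZMod ℓ) ≃* Multiplicative (AddAut V)) := by
  classical
  have hprime : ℓ.Prime := Fact.out
  haveI : Finite V :=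
    Nat.finite_of_card_ne_zero (by rw [hcard]; exact pow_ne_zero _ hprime.ne_zero)
  haveI : Module.Finite (ZMod ℓ) V := Module.Finite.of_finite
  have hrank : Module.finrank (ZMod ℓ) V = 2 := by
    have h := Module.natCard_eq_pow_finrank (K := ZMod ℓ) (V := V)
    rw [hcard, Nat.card_zmod] at h
    exact (Nat.pow_right_injective hprime.two_le h).symm
  let bV := Module.finBasisOfFinrankEq (ZMod ℓ) V hrank
  -- matrix ↦ invertible linear map (an isomorphism of unit groups)
  let Φ₁ : Matrix.GeneralLinearGroup (Fin 2) (ZMod ℓ) ≃* (V →ₗ[ZMod ℓ] V)ˣ :=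
    Units.mapEquiv (Matrix.toLinAlgEquiv bV).toMulEquiv
  -- invertible linear map ↦ additive automorphism
  let Φ₂ : (V →ₗ[ZMod ℓ] V)ˣ →* Multiplicative (AddAut V) :=
    DistribMulAction.toAddAut (V →ₗ[ZMod ℓ] V)ˣ V
  have h2 : Function.Injective Φ₂ := by
    intro x y hxy
    apply Units.ext
    apply LinearMap.ext
    intro v
    have h := AddEquiv.congr_fun hxy v
    simpa [Φ₂, DistribMulAction.toAddAut_apply, DistribMulAction.toAddEquiv_apply,
      Units.smul_def, Module.End.smul_def] using h
  have h2s : Function.Surjective Φ₂ := by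
    intro e
    -- the additive automorphism `e` is `ℤ/ℓ`-linear
    let eV : V ≃ₗ[ZMod ℓ] V :=
      { (Multiplicative.toAdd e).toAddMonoidHom.toZModLinearMap ℓ with
        invFun := (Multiplicative.toAdd e).symm
        left_inv := (Multiplicative.toAdd e).left_inv
        right_inv := (Multiplicative.toAdd e).right_inv }
    refine ⟨LinearMap.GeneralLinearGroup.ofLinearEquiv eV, ?_⟩
    apply Multiplicative.toAdd.injective
    refine AddEquiv.ext fun v ↦ ?_
    rfl
  exact ⟨Φ₁.trans (MulEquiv.ofBijective Φ₂ ⟨h2, h2s⟩)⟩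

/-- **Registered stub `stub_imageDichotomyCore`** (algebraic core of the endomorphism-field
dichotomy, signature verbatim): with `ρ`, `π`, `V` as above and `ℓ ≥ 5`, either
`ℓ ≤ rank H + 1` or `π(ker ρ)` contains the commutator subgroup of `Aut V`. -/
theorem stub_imageDichotomyCore :
    ∀ (ℓ : ℕ) [Fact ℓ.Prime], 5 ≤ ℓ →
      ∀ {Γ H V : Type} [Group Γ] [AddCommGroup H] [Module.Free ℤ H] [Module.Finite ℤ H]
        [AddCommGroup V], Nat.card V = ℓ ^ 2 → (∀ v : V, (ℓ : ℤ) • v = 0) →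
        ∀ (ρ : Representation ℤ Γ H), (Set.range ρ).Finite →
        ∀ (π : Γ →* Multiplicative (AddAut V)), Function.Surjective π →
          ℓ ≤ Module.finrank ℤ H + 1 ∨
          commutator (Multiplicative (AddAut V)) ≤ (ρ.asGroupHom.ker).map π := by
  intro ℓ _ h5 Γ H V _ _ _ _ _ hcard htor ρ hfin π hπ
  have hprime : ℓ.Prime := Fact.out
  -- `V` is a `ℤ/ℓ`-module; `GL₂(ℤ/ℓ) ≅ Aut(V)` and the two matrices
  haveI : Module (ZMod ℓ) V :=
    AddCommGroup.zmodModule fun v ↦ by rw [← natCast_zsmul]; exact htor v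
  obtain ⟨Ψ⟩ := exists_generalLinearGroup_mulEquiv V hcard
  obtain ⟨U, S, hUℓ, hUS⟩ := exists_unipotent_swap ℓ
  -- `K = ker ρ`, `N = π(K)` normal, `N' = Ψ⁻¹(N)` normal in `GL₂(ℤ/ℓ)`
  let K : Subgroup Γ := ρ.asGroupHom.ker
  let N : Subgroup (Multiplicative (AddAut V)) := K.map π
  haveI hN : N.Normal := Subgroup.Normal.map inferInstance π hπ
  let N' : Subgroup (GL (Fin 2) (ZMod ℓ)) := N.comap Ψ.toMonoidHom
  haveI : N'.Normal := Subgroup.Normal.comap hN _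
  rcases Literature.NumberTheory.GaloisRepresentations.toGL_range_le_or_le_center_of_normal_zmod
    h5 N' with hSL | hZ
  · -- `SL₂ ≤ N'`: the commutator subgroup of `Aut V` lies in `N`
    right
    have hcomm : commutator (GL (Fin 2) (ZMod ℓ)) ≤ N' := by
      refine le_trans ?_ hSL
      rw [Literature.NumberTheory.GaloisRepresentations.toGL_range_eq_det_ker]
      exact Abelianization.commutator_subset_ker _
    have hmap : commutator (Multiplicative (AddAut V)) =
        (commutator (GL (Fin 2) (ZMod ℓ))).map Ψ.toMonoidHom := by
      rw [commutator_def, commutator_def, Subgroup.map_commutator,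
        Subgroup.map_top_of_surjective _ Ψ.surjective]
    rw [hmap]
    exact (Subgroup.map_mono hcomm).trans (Subgroup.map_comap_le _ _)
  · -- `N'` central: the unipotent survives, `ℓ ∣ [Aut V : N] ∣ #ρ(Γ)`; Minkowski
    left
    have hUN : Ψ U ∉ N := by
      intro h
      have hU : U ∈ Subgroup.center (GL (Fin 2) (ZMod ℓ)) := hZ (Subgroup.mem_comap.mpr h)
      rw [Subgroup.mem_center_iff] at hU
      exact hUS (hU (S * U * S⁻¹)).symm
    have hord : orderOf (QuotientGroup.mk (Ψ U) : Multiplicative (AddAut V) ⧸ N) = ℓ := by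
      refine orderOf_eq_prime ?_ ?_
      · rw [← QuotientGroup.mk_pow, ← map_pow, hUℓ, map_one, QuotientGroup.mk_one]
      · intro h
        exact hUN ((QuotientGroup.eq_one_iff _).mp h)
    have hdvdN : ℓ ∣ N.index := by
      rw [Subgroup.index_eq_card, ← hord]
      exact orderOf_dvd_natCard _
    have hdvdK : ℓ ∣ K.index := hdvdN.trans (Subgroup.index_map_dvd (H := K) hπ)
    have hK : K.index = Nat.card ρ.asGroupHom.range := Subgroup.index_ker ρ.asGroupHom
    rw [hK] at hdvdK
    haveI : Finite ρ.asGroupHom.range := BigImage.finite_range_asGroupHom ρ hfin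
    obtain ⟨G, ⟨e⟩⟩ := BigImage.exists_subgroup_generalLinearGroup_mulEquiv ρ
    haveI : Finite G := Finite.of_equiv _ e.toEquiv
    rw [Nat.card_congr e.toEquiv] at hdvdK
    exact stub_minkowski _ ℓ hprime G hdvdK

end Summit.ABC.ABC.Theorems.GluingSlices

end
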